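import Summits.CriticalPhenomena.PercolationContinuityZ3.Theorems.PercNearOneGluingNoHeavyLowerTailSahiOneStepProfileGridOrStepAtoms
import HarnessLib

/-!
# THE OR-CYLINDER STEP for `(2′)` — part 1/3: bookkeeping and `(S1′)`

Prover prim-ineq-prove-3 gen 45 (`--supports stmt-CriticalPhenomena-4575`; memo
`run/shared/lean/prim/prim-ineq-prove-3/PROOF-G45-CHAIN-RULE.md` §5).  Uses `…ProfileGridOrStepPrelim` (two-piece identity
`orStep_arith`, abstract fibre lemmas `orStep_T_of_S1`, `orStep_M1_fibre`, `orStep_M2_fibre`), `…ProfileGridOrStepFibre` (point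
restriction, `ball_mono_fibre`) and `…ProfileGridOrStepAtoms` (`fibre_factor`, `fibre_monA`, `fibre_monZ`).

**`gridK_orStep`.**  `φ_j` `PF₂` weights on `{0,…,N}` (not normalised), `Φ = Π φ_j`, slot `{Σ_j v_j ≥ t}`; `i` a coordinate, `c` a cut,
`C` an event NOT depending on `v_i`; `u` a numerator with `0 ≤ u ≤ Φ` and the one-coordinate cross inequalities.  HYPOTHESES, in the
homogeneous cubic form `K̃` of `…ProfileGridChainRule`: (H0) `K̃ ≥ 0` for the LOW piece (`φ_i` restricted to `{n < c}`, numerator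
`u·1[v_i < c]`) against `C` at slot `t`; (H1) `K̃ ≥ 0` for every POINT piece `v_i = y`, `c ≤ y ≤ N` (numerator `u·1[v_i = y]`) against `C`
at every shifted slot `t + y − x`, `x < c`.  CONCLUSION: `K̃(Φ, u; {c ≤ v_i} ∪ C) ≥ 0` at slot `t`.
THIS FILE: fibre bookkeeping and the transported class hypothesis `orStep_S1`.
PROOF = memo §5: the eleven atoms of the two pieces, `M̃₁ = Σ_{x<c} m_x` with `m_x ≥ 0` (`orStep_M1_fibre`, fed by `(S1′)` = (H1) in complement
form transported to the fibre `x`, ball monotonicity and the two chain monotonicities), `M̃₂' = Σ_{y≥c} n_y` with `n_y ≥ 0`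
(`orStep_M2_fibre`), and `orStep_arith`.  No definitions, no sorries.
-/

noncomputable section

namespace Summit.CriticalPhenomena.PercolationContinuityZ3.Theorems

namespace SahiOneStep

namespace ProfileGrid

open Finset Function
open Literature.Probability.Distributions (IsLogConcaveSeq piWeight blockSum)
open scoped Classical

variable {κ : Type*} [Fintype κ] [DecidableEq κ] {N : ℕ}

/-! ## Bookkeeping -/

/-- Restricting `φ_i` to `{n < c}` multiplies the product weight by `1[v_i < c]`. [folklore] -/
theorem piWeight_update_truncLT (φ : κ → ℕ → ℝ) (i : κ) (c : ℕ) (v : κ → Fin (N + 1)) :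
    piWeight N (update φ i (fun n => if n < c then φ i n else 0)) v = if (v i : ℕ) < c then piWeight N φ v else 0 := by
  rw [piWeight_eq_mul_erase _ i, piWeight_eq_mul_erase φ i, update_self]
  have : ∏ j ∈ univ.erase i, update φ i (fun n => if n < c then φ i n else 0) j (v j) = ∏ j ∈ univ.erase i, φ j (v j) :=
    prod_congr rfl fun j hj => by rw [update_of_ne (ne_of_mem_erase hj)]
  rw [this]
  split_ifs <;> simp

/-- **Decomposition into fibres of coordinate `i`, restricted by a predicate on `v_i`.** [folklore] -/
theorem sum_fibre_filter (i : κ) (Q : ℕ → Prop) [DecidablePred Q] (F : (κ → Fin (N + 1)) → ℝ) :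
    (∑ v : κ → Fin (N + 1), if Q (v i : ℕ) then F v else 0) =
      ∑ y ∈ (range (N + 1)).filter Q, ∑ v : κ → Fin (N + 1), if (v i : ℕ) = y then F v else 0 := by
  rw [sum_comm]
  refine sum_congr rfl fun v _ => ?_
  rw [sum_filter]
  have hv : (v i : ℕ) ∈ range (N + 1) := mem_range.2 (v i).2
  rw [← sum_filter_add_sum_filter_not (range (N + 1)) (fun y => y = (v i : ℕ))]
  have h1 : (range (N + 1)).filter (fun y => y = (v i : ℕ)) = {(v i : ℕ)} := by
    ext y; simp only [mem_filter, mem_range, mem_singleton]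
    exact ⟨fun h => h.2, fun h => ⟨h ▸ (v i).2, h⟩⟩
  rw [h1, sum_singleton, if_pos rfl, sum_eq_zero (fun y hy => by
    rw [mem_filter] at hy; rw [if_neg (Ne.symm hy.2)]; split_ifs <;> rfl), add_zero]

/-- On the fibre `v_i = y` with `x ≤ y`: the shifted slot `t + y − x ≤ Σ v` is the slot `t ≤ Σ (v with v_i := x)`. [folklore] -/
theorem slot_shift_fibre {v : κ → Fin (N + 1)} {i : κ} {y : ℕ} (hv : (v i : ℕ) = y) (x : Fin (N + 1)) (hxy : (x : ℕ) ≤ y) (t : ℕ) :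
    t + y - (x : ℕ) ≤ blockSum univ v ↔ t ≤ blockSum univ (update v i x) := by
  rw [blockSum_univ_eq_add_erase v i, blockSum_univ_eq_add_erase (update v i x) i, update_self, blockSum_erase_update, hv]
  omega

/-! ## `(S1′)`: the class hypothesis at a point piece, in complement form, transported to a low fibre -/

/-- **`(S1′)`** (memo (5.3), homogeneous).  From `K̃ ≥ 0` for the point piece `v_i = y` against `C` at the shifted slot `t + y − x`
(`x ≤ y`): `z_y·m_y·U_x + z_y·k_y·W'_x ≤ m_y·a_y·Wc_x`, where `z_y, a_y` are the fibre-`y` masses of `Φ`, `u`; `m_y, k_y` those of the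
shifted lower ball `{t > Σ (v|v_i:=x)}`; and `U_x = u(fibre x ∩ H ∩ Cᶜ)`, `W'_x = Φ(fibre x ∩ Cᶜ ∩ L)`, `Wc_x = Φ(fibre x ∩ Cᶜ)`. [this work] -/
theorem orStep_S1 (φ : κ → ℕ → ℝ) (hφ0 : ∀ j n, 0 ≤ φ j n) (i : κ) (t : ℕ)
    (PC : (κ → Fin (N + 1)) → Prop) [DecidablePred PC] (hPCi : ∀ v k, PC (update v i k) ↔ PC v)
    {u : (κ → Fin (N + 1)) → ℝ} (hu0 : ∀ v, 0 ≤ u v)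
    (hmono : ∀ v j (x x' : Fin (N + 1)), x ≤ x' → u (update v j x) * φ j x' ≤ u (update v j x') * φ j x)
    (x : Fin (N + 1)) {y : ℕ} (hxy : (x : ℕ) ≤ y) (hyN : y ≤ N)
    (h : 0 ≤ (∑ v : κ → Fin (N + 1), piWeight N (update φ i (fun n => if n = y then φ i n else 0)) v) *
          (∑ v : κ → Fin (N + 1), if ¬ t + y - (x : ℕ) ≤ blockSum univ v then
            piWeight N (update φ i (fun n => if n = y then φ i n else 0)) v else 0) *
          (∑ v : κ → Fin (N + 1), if t + y - (x : ℕ) ≤ blockSum univ v ∧ PC v then (if (v i : ℕ) = y then u v else 0) else 0)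
        + (∑ v : κ → Fin (N + 1), piWeight N (update φ i (fun n => if n = y then φ i n else 0)) v) *
          (∑ v : κ → Fin (N + 1), if ¬ t + y - (x : ℕ) ≤ blockSum univ v then (if (v i : ℕ) = y then u v else 0) else 0) *
          (∑ v : κ → Fin (N + 1), if PC v ∧ ¬ t + y - (x : ℕ) ≤ blockSum univ v then
            piWeight N (update φ i (fun n => if n = y then φ i n else 0)) v else 0)
        - (∑ v : κ → Fin (N + 1), if ¬ t + y - (x : ℕ) ≤ blockSum univ v then
            piWeight N (update φ i (fun n => if n = y then φ i n else 0)) v else 0) *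
          (∑ v : κ → Fin (N + 1), (if (v i : ℕ) = y then u v else 0)) *
          (∑ v : κ → Fin (N + 1), if PC v then piWeight N (update φ i (fun n => if n = y then φ i n else 0)) v else 0)) :
    (∑ v : κ → Fin (N + 1), if (v i : ℕ) = y then piWeight N φ v else 0) *
        (∑ v : κ → Fin (N + 1), if (v i : ℕ) = y ∧ ¬ t ≤ blockSum univ (update v i x) then piWeight N φ v else 0) *
        (∑ v : κ → Fin (N + 1), if (v i : ℕ) = (x : ℕ) ∧ (t ≤ blockSum univ v ∧ ¬ PC v) then u v else 0)
      + (∑ v : κ → Fin (N + 1), if (v i : ℕ) = y then piWeight N φ v else 0) *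
        (∑ v : κ → Fin (N + 1), if (v i : ℕ) = y ∧ ¬ t ≤ blockSum univ (update v i x) then u v else 0) *
        (∑ v : κ → Fin (N + 1), if (v i : ℕ) = (x : ℕ) ∧ (¬ PC v ∧ ¬ t ≤ blockSum univ v) then piWeight N φ v else 0) ≤
      (∑ v : κ → Fin (N + 1), if (v i : ℕ) = y ∧ ¬ t ≤ blockSum univ (update v i x) then piWeight N φ v else 0) *
        (∑ v : κ → Fin (N + 1), if (v i : ℕ) = y then u v else 0) *
        (∑ v : κ → Fin (N + 1), if (v i : ℕ) = (x : ℕ) ∧ ¬ PC v then piWeight N φ v else 0) := by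
  have hw0 : ∀ v, 0 ≤ piWeight N φ v := fun v => piWeight_nonneg hφ0 v
  simp only [piWeight_update_point] at h
  -- Step 2: the seven sums of `h` in fibre form (shifted slot ↔ slot of `v|v_i:=x` on the fibre)
  have hs : ∀ v : κ → Fin (N + 1), (v i : ℕ) = y → (t + y - (x : ℕ) ≤ blockSum univ v ↔ t ≤ blockSum univ (update v i x)) :=
    fun v hv => slot_shift_fibre hv x hxy t
  have e2 : (∑ v : κ → Fin (N + 1), if ¬ t + y - (x : ℕ) ≤ blockSum univ v then (if (v i : ℕ) = y then piWeight N φ v else 0) else 0) =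
      ∑ v : κ → Fin (N + 1), if (v i : ℕ) = y ∧ ¬ t ≤ blockSum univ (update v i x) then piWeight N φ v else 0 :=
    sum_congr rfl fun v _ => by
      by_cases hv : (v i : ℕ) = y
      · by_cases h2 : t ≤ blockSum univ (update v i x)
        · rw [if_neg (not_not.2 ((hs v hv).2 h2)), if_neg (fun hh => hh.2 h2)]
        · rw [if_pos (fun hh => h2 ((hs v hv).1 hh)), if_pos hv, if_pos ⟨hv, h2⟩]
      · simp [hv]
  have e3 : (∑ v : κ → Fin (N + 1), if t + y - (x : ℕ) ≤ blockSum univ v ∧ PC v then (if (v i : ℕ) = y then u v else 0) else 0) =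
      ∑ v : κ → Fin (N + 1), if (v i : ℕ) = y ∧ (t ≤ blockSum univ (update v i x) ∧ PC v) then u v else 0 :=
    sum_congr rfl fun v _ => by
      by_cases hv : (v i : ℕ) = y
      · by_cases h2 : t ≤ blockSum univ (update v i x)
        · by_cases h3 : PC v
          · rw [if_pos ⟨(hs v hv).2 h2, h3⟩, if_pos hv, if_pos ⟨hv, h2, h3⟩]
          · rw [if_neg (fun hh => h3 hh.2), if_neg (fun hh => h3 hh.2.2)]
        · rw [if_neg (fun hh => h2 ((hs v hv).1 hh.1)), if_neg (fun hh => h2 hh.2.1)]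
      · simp [hv]
  have e4 : (∑ v : κ → Fin (N + 1), if ¬ t + y - (x : ℕ) ≤ blockSum univ v then (if (v i : ℕ) = y then u v else 0) else 0) =
      ∑ v : κ → Fin (N + 1), if (v i : ℕ) = y ∧ ¬ t ≤ blockSum univ (update v i x) then u v else 0 :=
    sum_congr rfl fun v _ => by
      by_cases hv : (v i : ℕ) = y
      · by_cases h2 : t ≤ blockSum univ (update v i x)
        · rw [if_neg (not_not.2 ((hs v hv).2 h2)), if_neg (fun hh => hh.2 h2)]
        · rw [if_pos (fun hh => h2 ((hs v hv).1 hh)), if_pos hv, if_pos ⟨hv, h2⟩]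
      · simp [hv]
  have e5 : (∑ v : κ → Fin (N + 1), if PC v ∧ ¬ t + y - (x : ℕ) ≤ blockSum univ v then (if (v i : ℕ) = y then piWeight N φ v else 0) else 0) =
      ∑ v : κ → Fin (N + 1), if (v i : ℕ) = y ∧ (PC v ∧ ¬ t ≤ blockSum univ (update v i x)) then piWeight N φ v else 0 :=
    sum_congr rfl fun v _ => by
      by_cases hv : (v i : ℕ) = y
      · by_cases h3 : PC v
        · by_cases h2 : t ≤ blockSum univ (update v i x)
          · rw [if_neg (fun hh => hh.2 ((hs v hv).2 h2)), if_neg (fun hh => hh.2.2 h2)]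
          · rw [if_pos ⟨h3, fun hh => h2 ((hs v hv).1 hh)⟩, if_pos hv, if_pos ⟨hv, h3, h2⟩]
        · rw [if_neg (fun hh => h3 hh.1), if_neg (fun hh => h3 hh.2.1)]
      · simp [hv]
  have e7 : (∑ v : κ → Fin (N + 1), if PC v then (if (v i : ℕ) = y then piWeight N φ v else 0) else 0) =
      ∑ v : κ → Fin (N + 1), if (v i : ℕ) = y ∧ PC v then piWeight N φ v else 0 :=
    sum_congr rfl fun v _ => by
      by_cases hv : (v i : ℕ) = y <;> by_cases h3 : PC v <;> simp [hv, h3]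
  rw [e2, e3, e4, e5, e7] at h
  -- Step 3: complements on the fibre `y`
  have c1 : (∑ v : κ → Fin (N + 1), if (v i : ℕ) = y ∧ (t ≤ blockSum univ (update v i x) ∧ PC v) then u v else 0) +
      (∑ v : κ → Fin (N + 1), if (v i : ℕ) = y ∧ (t ≤ blockSum univ (update v i x) ∧ ¬ PC v) then u v else 0) +
      (∑ v : κ → Fin (N + 1), if (v i : ℕ) = y ∧ ¬ t ≤ blockSum univ (update v i x) then u v else 0) =
      ∑ v : κ → Fin (N + 1), if (v i : ℕ) = y then u v else 0 := by
    rw [← sum_add_distrib, ← sum_add_distrib]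
    exact sum_congr rfl fun v _ => by
      by_cases hv : (v i : ℕ) = y <;> by_cases h2 : t ≤ blockSum univ (update v i x) <;> by_cases h3 : PC v <;> simp [hv, h2, h3]
  have c3 : (∑ v : κ → Fin (N + 1), if (v i : ℕ) = y ∧ (PC v ∧ ¬ t ≤ blockSum univ (update v i x)) then piWeight N φ v else 0) +
      (∑ v : κ → Fin (N + 1), if (v i : ℕ) = y ∧ (¬ PC v ∧ ¬ t ≤ blockSum univ (update v i x)) then piWeight N φ v else 0) =
      ∑ v : κ → Fin (N + 1), if (v i : ℕ) = y ∧ ¬ t ≤ blockSum univ (update v i x) then piWeight N φ v else 0 := by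
    rw [← sum_add_distrib]
    exact sum_congr rfl fun v _ => by
      by_cases hv : (v i : ℕ) = y <;> by_cases h2 : t ≤ blockSum univ (update v i x) <;> by_cases h3 : PC v <;> simp [hv, h2, h3]
  have c4 : (∑ v : κ → Fin (N + 1), if (v i : ℕ) = y ∧ PC v then piWeight N φ v else 0) +
      (∑ v : κ → Fin (N + 1), if (v i : ℕ) = y ∧ ¬ PC v then piWeight N φ v else 0) =
      ∑ v : κ → Fin (N + 1), if (v i : ℕ) = y then piWeight N φ v else 0 := by
    rw [← sum_add_distrib]
    exact sum_congr rfl fun v _ => by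
      by_cases hv : (v i : ℕ) = y <;> by_cases h3 : PC v <;> simp [hv, h3]
  -- Step 4: cross-fibre transport (`x ≤ y`)
  have hxN : (x : ℕ) ≤ N := Nat.lt_succ_iff.1 x.2
  set y' : Fin (N + 1) := ⟨y, Nat.lt_succ_of_le hyN⟩ with hy'
  have hxy' : x ≤ y' := by rw [hy']; exact Fin.le_def.2 (by simpa using hxy)
  have fin_iff : ∀ (v : κ → Fin (N + 1)) (k : Fin (N + 1)), (v i = k) ↔ ((v i : ℕ) = (k : ℕ)) := fun v k => Fin.ext_iff
  -- generic converter: `Σ_{v i = k} Φ·1_E = Σ_{(v i:ℕ) = k ∧ E} Φ` and the same for `u`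
  have convW : ∀ (E : (κ → Fin (N + 1)) → Prop) [DecidablePred E] (k : Fin (N + 1)),
      (∑ v : κ → Fin (N + 1), if v i = k then piWeight N φ v * (if E v then (1 : ℝ) else 0) else 0) =
        ∑ v : κ → Fin (N + 1), if (v i : ℕ) = (k : ℕ) ∧ E v then piWeight N φ v else 0 := by
    intro E _ k
    refine sum_congr rfl fun v _ => ?_
    by_cases hv : v i = k
    · have hv' : (v i : ℕ) = (k : ℕ) := (fin_iff v k).1 hv
      by_cases hE : E v
      · rw [if_pos hv, if_pos hE, if_pos ⟨hv', hE⟩, mul_one]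
      · rw [if_pos hv, if_neg hE, if_neg (fun hh => hE hh.2), mul_zero]
    · rw [if_neg hv, if_neg (fun hh => hv ((fin_iff v k).2 hh.1))]
  have convU : ∀ (E : (κ → Fin (N + 1)) → Prop) [DecidablePred E] (k : Fin (N + 1)),
      (∑ v : κ → Fin (N + 1), if v i = k then u v * (if E v then (1 : ℝ) else 0) else 0) =
        ∑ v : κ → Fin (N + 1), if (v i : ℕ) = (k : ℕ) ∧ E v then u v else 0 := by
    intro E _ k
    refine sum_congr rfl fun v _ => ?_
    by_cases hv : v i = k
    · have hv' : (v i : ℕ) = (k : ℕ) := (fin_iff v k).1 hv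
      by_cases hE : E v
      · rw [if_pos hv, if_pos hE, if_pos ⟨hv', hE⟩, mul_one]
      · rw [if_pos hv, if_neg hE, if_neg (fun hh => hE hh.2), mul_zero]
    · rw [if_neg hv, if_neg (fun hh => hv ((fin_iff v k).2 hh.1))]
  -- on the fibre `x`: the shifted slot is the true slot
  have hfx : ∀ v : κ → Fin (N + 1), (v i : ℕ) = (x : ℕ) → (t ≤ blockSum univ (update v i x) ↔ t ≤ blockSum univ v) := by
    intro v hv
    rw [show update v i x = v from by rw [← Fin.ext hv, update_eq_self]]
  -- x1: `φ x · Gc_y = φ y · Wc_x`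
  have x1 := fibre_cross_eq φ i (fun v => if ¬ PC v then (1 : ℝ) else 0) (fun v k => by simp only [hPCi]) x y'
  rw [convW (fun v => ¬ PC v) x, convW (fun v => ¬ PC v) y'] at x1
  -- x2: `φ x · Gcl_y = φ y · Wcl_x`
  have x2 := fibre_cross_eq φ i (fun v => if ¬ PC v ∧ ¬ t ≤ blockSum univ (update v i x) then (1 : ℝ) else 0)
    (fun v k => by simp only [hPCi, update_idem]) x y'
  rw [convW (fun v => ¬ PC v ∧ ¬ t ≤ blockSum univ (update v i x)) x,
    convW (fun v => ¬ PC v ∧ ¬ t ≤ blockSum univ (update v i x)) y'] at x2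
  have x2' : (∑ v : κ → Fin (N + 1), if (v i : ℕ) = (x : ℕ) ∧ (¬ PC v ∧ ¬ t ≤ blockSum univ (update v i x)) then piWeight N φ v else 0) =
      ∑ v : κ → Fin (N + 1), if (v i : ℕ) = (x : ℕ) ∧ (¬ PC v ∧ ¬ t ≤ blockSum univ v) then piWeight N φ v else 0 :=
    sum_congr rfl fun v _ => by
      by_cases hv : (v i : ℕ) = (x : ℕ)
      · simp only [hv, hfx v hv, true_and]
      · rw [if_neg (fun hh => hv hh.1), if_neg (fun hh => hv hh.1)]
  rw [x2'] at x2
  -- x4: `φ y · Uch_x ≤ φ x · Uhcc_y`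
  have x4 := fibre_cross_le φ i hmono (fun v => if t ≤ blockSum univ (update v i x) ∧ ¬ PC v then (1 : ℝ) else 0)
    (fun v k => by simp only [hPCi, update_idem]) (fun v => by split_ifs <;> norm_num) hxy'
  rw [convU (fun v => t ≤ blockSum univ (update v i x) ∧ ¬ PC v) x,
    convU (fun v => t ≤ blockSum univ (update v i x) ∧ ¬ PC v) y'] at x4
  have x4' : (∑ v : κ → Fin (N + 1), if (v i : ℕ) = (x : ℕ) ∧ (t ≤ blockSum univ (update v i x) ∧ ¬ PC v) then u v else 0) =
      ∑ v : κ → Fin (N + 1), if (v i : ℕ) = (x : ℕ) ∧ (t ≤ blockSum univ v ∧ ¬ PC v) then u v else 0 :=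
    sum_congr rfl fun v _ => by
      by_cases hv : (v i : ℕ) = (x : ℕ)
      · simp only [hv, hfx v hv, true_and]
      · rw [if_neg (fun hh => hv hh.1), if_neg (fun hh => hv hh.1)]
  rw [x4'] at x4
  -- the fibre-`y` mass factorises through `φ i y`
  have hz := fibre_factor φ i (fun _ => (1 : ℝ)) hyN
  have ez : (∑ v : κ → Fin (N + 1), if (v i : ℕ) = y then piWeight N φ v * (fun _ => (1 : ℝ)) v else 0) =
      ∑ v : κ → Fin (N + 1), if (v i : ℕ) = y then piWeight N φ v else 0 := sum_congr rfl fun v _ => by split_ifs <;> simp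
  rw [ez] at hz
  simp only [Fin.val_mk, hy'] at x1 x2 x4
  -- Step 5: generalise the atoms and conclude
  have nn1 : 0 ≤ ∑ v : κ → Fin (N + 1), if (v i : ℕ) = y then piWeight N φ v else 0 := sum_ite_nonneg' hw0 _
  have nn2 : 0 ≤ ∑ v : κ → Fin (N + 1), if (v i : ℕ) = y ∧ ¬ t ≤ blockSum univ (update v i x) then piWeight N φ v else 0 :=
    sum_ite_nonneg' hw0 _
  have nn3 : 0 ≤ ∑ v : κ → Fin (N + 1), if (v i : ℕ) = y ∧ ¬ t ≤ blockSum univ (update v i x) then u v else 0 := sum_ite_nonneg' hu0 _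
  have nn4 : 0 ≤ ∑ v : κ → Fin (N + 1), if (v i : ℕ) = y then u v else 0 := sum_ite_nonneg' hu0 _
  have nn5 : 0 ≤ ∑ v : κ → Fin (N + 1), if (v i : ℕ) = (x : ℕ) ∧ ¬ PC v then piWeight N φ v else 0 := sum_ite_nonneg' hw0 _
  have nn6 : 0 ≤ ∑ v : κ → Fin (N + 1), if (v i : ℕ) = (x : ℕ) ∧ (t ≤ blockSum univ v ∧ ¬ PC v) then u v else 0 := sum_ite_nonneg' hu0 _
  have hφx : 0 ≤ φ i x := hφ0 i x
  have hφy : 0 ≤ φ i y := hφ0 i y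
  have hR0 : 0 ≤ ∑ v : κ → Fin (N + 1), if (v i : ℕ) = 0 then
      (∏ j ∈ univ.erase i, φ j (v j)) * (fun _ => (1 : ℝ)) (update v i ⟨y, Nat.lt_succ_of_le hyN⟩) else 0 :=
    sum_nonneg fun v _ => by
      split_ifs
      · exact mul_nonneg (prod_erase_nonneg hφ0 i v) zero_le_one
      · exact le_rfl
  generalize (∑ v : κ → Fin (N + 1), if (v i : ℕ) = 0 then
      (∏ j ∈ univ.erase i, φ j (v j)) * (fun _ => (1 : ℝ)) (update v i ⟨y, Nat.lt_succ_of_le hyN⟩) else 0) = R at *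
  generalize (∑ v : κ → Fin (N + 1), if (v i : ℕ) = y then piWeight N φ v else 0) = zF at *
  generalize (∑ v : κ → Fin (N + 1), if (v i : ℕ) = y ∧ ¬ t ≤ blockSum univ (update v i x) then piWeight N φ v else 0) = mF at *
  generalize (∑ v : κ → Fin (N + 1), if (v i : ℕ) = y ∧ (t ≤ blockSum univ (update v i x) ∧ PC v) then u v else 0) = Uhc at *
  generalize (∑ v : κ → Fin (N + 1), if (v i : ℕ) = y ∧ (t ≤ blockSum univ (update v i x) ∧ ¬ PC v) then u v else 0) = Uhcc at *
  generalize (∑ v : κ → Fin (N + 1), if (v i : ℕ) = y ∧ ¬ t ≤ blockSum univ (update v i x) then u v else 0) = kF at *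
  generalize (∑ v : κ → Fin (N + 1), if (v i : ℕ) = y ∧ (PC v ∧ ¬ t ≤ blockSum univ (update v i x)) then piWeight N φ v else 0) = Gl at *
  generalize (∑ v : κ → Fin (N + 1), if (v i : ℕ) = y ∧ (¬ PC v ∧ ¬ t ≤ blockSum univ (update v i x)) then piWeight N φ v else 0) =
    Gcl at *
  generalize (∑ v : κ → Fin (N + 1), if (v i : ℕ) = y then u v else 0) = aF at *
  generalize (∑ v : κ → Fin (N + 1), if (v i : ℕ) = y ∧ PC v then piWeight N φ v else 0) = G at *
  generalize (∑ v : κ → Fin (N + 1), if (v i : ℕ) = y ∧ ¬ PC v then piWeight N φ v else 0) = Gc at *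
  generalize (∑ v : κ → Fin (N + 1), if (v i : ℕ) = (x : ℕ) ∧ (t ≤ blockSum univ v ∧ ¬ PC v) then u v else 0) = Uch at *
  generalize (∑ v : κ → Fin (N + 1), if (v i : ℕ) = (x : ℕ) ∧ (¬ PC v ∧ ¬ t ≤ blockSum univ v) then piWeight N φ v else 0) = Wcl at *
  generalize (∑ v : κ → Fin (N + 1), if (v i : ℕ) = (x : ℕ) ∧ ¬ PC v then piWeight N φ v else 0) = Wc at *
  -- complement form of `h`
  have star : zF * mF * Uhcc + zF * kF * Gcl ≤ mF * aF * Gc := by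
    have e : zF * mF * Uhcc + zF * kF * Gcl - mF * aF * Gc = -(zF * mF * Uhc + zF * kF * Gl - mF * aF * G) := by
      rw [show Uhcc = aF - kF - Uhc by linarith, show Gcl = mF - Gl by linarith, show Gc = zF - G by linarith]; ring
    linarith
  -- multiply by `φ i x`, transport to the fibre `x`, divide by `φ i y`
  rcases hφy.lt_or_eq with hpos | hzero
  · have key : φ i y * (zF * mF * Uch + zF * kF * Wcl) ≤ φ i y * (mF * aF * Wc) := by
      have t1 : zF * mF * (φ i y * Uch) ≤ zF * mF * (φ i x * Uhcc) := mul_le_mul_of_nonneg_left x4 (mul_nonneg nn1 nn2)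
      have t2 : φ i x * (zF * mF * Uhcc + zF * kF * Gcl) ≤ φ i x * (mF * aF * Gc) := mul_le_mul_of_nonneg_left star hφx
      have t3 : zF * kF * (φ i y * Wcl) = zF * kF * (φ i x * Gcl) := by rw [x2]
      have t4 : mF * aF * (φ i y * Wc) = mF * aF * (φ i x * Gc) := by rw [x1]
      linarith [t1, t2, t3, t4]
    exact le_of_mul_le_mul_left key hpos
  · -- `φ i y = 0`: the fibre `y` is null
    have hzF : zF = 0 := by rw [hz, ← hzero, zero_mul]
    rw [hzF]; simp only [zero_mul, zero_add]
    exact mul_nonneg (mul_nonneg nn2 nn4) nn5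

/-- (Version of `fibre_monA` with the caller's `Decidable` instance for `E`.)  `a/z` is non-decreasing: `a_y·z_{y'} ≤ a_{y'}·z_y` for `y ≤ y'`, for the numerator restricted to an `i`-invariant event `E`
(`a_y = u(fibre y ∩ E)`, `z_y = Φ(fibre y)`). [this work] -/
theorem fibre_monA_dec (φ : κ → ℕ → ℝ) (hφ0 : ∀ j n, 0 ≤ φ j n) (i : κ) {u : (κ → Fin (N + 1)) → ℝ}
    (hmono : ∀ v j (x x' : Fin (N + 1)), x ≤ x' → u (update v j x) * φ j x' ≤ u (update v j x') * φ j x)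
    (E : (κ → Fin (N + 1)) → Prop) [DecidablePred E] (hE : ∀ v k, E (update v i k) ↔ E v) {y y' : ℕ} (hyy' : y ≤ y') (hy' : y' ≤ N) :
    (∑ v : κ → Fin (N + 1), if (v i : ℕ) = y ∧ E v then u v else 0) * (∑ v : κ → Fin (N + 1), if (v i : ℕ) = y' then piWeight N φ v else 0) ≤
      (∑ v : κ → Fin (N + 1), if (v i : ℕ) = y' ∧ E v then u v else 0) * (∑ v : κ → Fin (N + 1), if (v i : ℕ) = y then piWeight N φ v else 0) := by
  have hy : y ≤ N := hyy'.trans hy'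
  -- `z_y = φ_i(y)·R`, `z_{y'} = φ_i(y')·R`
  have hz := fun (yy : ℕ) (hyy : yy ≤ N) => fibre_factor φ i (fun _ => (1 : ℝ)) (y := yy) hyy
  have ez : ∀ yy : ℕ, (∑ v : κ → Fin (N + 1), if (v i : ℕ) = yy then piWeight N φ v * (fun _ => (1 : ℝ)) v else 0) =
      ∑ v : κ → Fin (N + 1), if (v i : ℕ) = yy then piWeight N φ v else 0 :=
    fun yy => sum_congr rfl fun v _ => by split_ifs <;> simp
  set R : ℝ := ∑ v : κ → Fin (N + 1), if (v i : ℕ) = 0 then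
      (∏ j ∈ univ.erase i, φ j (v j)) * (fun _ => (1 : ℝ)) (update v i ⟨y, Nat.lt_succ_of_le hy⟩) else 0 with hR
  have hR0 : 0 ≤ R := sum_nonneg fun v _ => by
    split_ifs
    · exact mul_nonneg (prod_erase_nonneg hφ0 i v) zero_le_one
    · exact le_rfl
  rw [← ez y, ← ez y', hz y hy, hz y' hy']
  -- cross-fibre inequality for the numerator: `φ_i(y')·a_y ≤ φ_i(y)·a_{y'}`
  have hg0 : ∀ v, 0 ≤ (if E v then (1 : ℝ) else 0) := fun v => by split_ifs <;> norm_num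
  have hgE : ∀ v k, (if E (update v i k) then (1 : ℝ) else 0) = if E v then 1 else 0 := fun v k => by simp only [hE v k]
  have cross := fibre_cross_le φ i hmono (fun v => if E v then (1 : ℝ) else 0) hgE hg0
    (k := ⟨y, Nat.lt_succ_of_le hy⟩) (k' := ⟨y', Nat.lt_succ_of_le hy'⟩) (by exact_mod_cast hyy')
  have e : ∀ (yy : ℕ) (hyy : yy ≤ N), (∑ v : κ → Fin (N + 1), if v i = (⟨yy, Nat.lt_succ_of_le hyy⟩ : Fin (N + 1)) then
      u v * (if E v then (1 : ℝ) else 0) else 0) = ∑ v : κ → Fin (N + 1), if (v i : ℕ) = yy ∧ E v then u v else 0 := by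
    intro yy hyy
    refine sum_congr rfl fun v _ => ?_
    by_cases hv : (v i : ℕ) = yy
    · rw [if_pos (Fin.ext hv)]
      by_cases h2 : E v
      · rw [if_pos h2, if_pos ⟨hv, h2⟩, mul_one]
      · rw [if_neg h2, if_neg (fun h => h2 h.2), mul_zero]
    · rw [if_neg (fun h' => hv (by rw [h'])), if_neg (fun h => hv h.1)]
  rw [e y hy, e y' hy'] at cross
  -- `a_y · (φ y' R) ≤ a_{y'} · (φ y R)`
  calc (∑ v : κ → Fin (N + 1), if (v i : ℕ) = y ∧ E v then u v else 0) * (φ i y' * R)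
      = (φ i y' * ∑ v : κ → Fin (N + 1), if (v i : ℕ) = y ∧ E v then u v else 0) * R := by ring
    _ ≤ (φ i y * ∑ v : κ → Fin (N + 1), if (v i : ℕ) = y' ∧ E v then u v else 0) * R :=
        mul_le_mul_of_nonneg_right cross hR0
    _ = _ := by ring

end ProfileGrid

end SahiOneStep

end Summit.CriticalPhenomena.PercolationContinuityZ3.Theorems
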